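import Mathlib

/-!
# Hodge-locus census (cell `pub-hlocus`, ENGINE A, gen 45) — the ℓ-local factor of a twisted divisor sum

certified instances and evidence bearing on the general Hodge conjecture; no claim.

This file is a GENERAL (non-computational) and DEFINITION-FREE lemma sheet, not an instance table.
For a completely multiplicative `χ : ℕ →*₀ ℤ` write `σ_χ(N) := ∑_{t ∣ N} χ(t)`.  For a prime `p ∤ n`
we prove the local factorisation `σ_χ(p^e · n) = (∑_{i ≤ e} χ(p)^i) · σ_χ(n)`
(`divisorSum_prime_pow_mul`) and its three specialisations

* `χ(p) = -1` ("inert"):    `σ_χ(p^{2e} n) = σ_χ(n)` and `σ_χ(p^{2e+1} n) = 0`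
  (`divisorSum_inert_even`, `divisorSum_inert_odd`, and the shift form `divisorSum_inert_shift`);
* `χ(p) = 0`  ("ramified"): `σ_χ(p^e n) = σ_χ(n)` (`divisorSum_ramified`);
* `χ(p) = 1`  ("split"):    `σ_χ(p^e n) = (e + 1) · σ_χ(n)` (`divisorSum_split`).

The proofs go through Mathlib's `ArithmeticFunction`: `σ_χ = χ * ζ` is multiplicative
(`IsMultiplicative.mul`, `isMultiplicative_zeta`), `coe_mul_zeta_apply`, `Nat.divisors_prime_pow`,
`neg_one_geom_sum`, `zero_geom_sum`.

Context (why the cell wants it): with `χ = χ_{d₁}` the Kronecker character of an imaginary quadratic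
field, `σ_χ(N)` is the number of integral ideals of norm `N` coprime to nothing (ENGINE A's
`ideal_count`, the core of the object `𝔄(N)` in A's transcription of
[cite: LauterViray2015SingularModuli, Thm. 1.5], arXiv:1206.6942); the factor
`c_p(e) ∈ {e+1, [e even], 1}` is Lemma 1 of the cell's derivation DERIVATION-GK-A.md §5af (the
"three-cell term-wise law" for the exponent `r` in `𝔄(m/ℓ^r)`, registered fresh-data test G45-TCL,
ABSHODGE LOG 2026-08-23T21:32:24Z).  Mechanism references: the local (Hilbert-symbol / ideal-count) factor
structure of [cite: GrossZagier1985SingularModuli, §3] and [cite: LauterViray2015SingularModuli, Prop. 8.1];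
census records (G44/G45 files of the cell) are data only and are not used here.  The character is kept
abstract (any completely multiplicative `ℕ →*₀ ℤ`); nothing in this file is specific to, or evidence
about, Hodge loci beyond that bookkeeping identity.  No `sorry`, no new axioms, no definitions.
-/

namespace Summit.HodgeConjecture.HodgeConjecture.HodgeLocus.Census.LVLocalFactor

open ArithmeticFunction Finset
open scoped ArithmeticFunction.zeta

set_option linter.dupNamespace false

/-- A completely multiplicative `χ : ℕ →*₀ ℤ`, viewed as the arithmetic function `⟨χ, map_zero χ⟩`,
is multiplicative in Mathlib's sense. -/
theorem isMultiplicative_chi (χ : ℕ →*₀ ℤ) :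
    IsMultiplicative (show ArithmeticFunction ℤ from ⟨(χ : ℕ → ℤ), map_zero χ⟩) :=
  ⟨by simp, fun {m n} _ => by simp [map_mul]⟩

/-- `(χ * ζ)(n) = ∑_{t ∣ n} χ(t)`. -/
theorem chi_mul_zeta_apply (χ : ℕ →*₀ ℤ) (n : ℕ) :
    ((show ArithmeticFunction ℤ from ⟨(χ : ℕ → ℤ), map_zero χ⟩) * (ζ : ArithmeticFunction ℤ)) n
      = ∑ t ∈ n.divisors, χ t := by
  rw [coe_mul_zeta_apply]; rfl

/-- Euler factor at a prime power: `∑_{t ∣ p^e} χ(t) = ∑_{i ≤ e} χ(p)^i`. -/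
theorem divisorSum_prime_pow (χ : ℕ →*₀ ℤ) {p : ℕ} (hp : p.Prime) (e : ℕ) :
    ∑ t ∈ (p ^ e).divisors, χ t = ∑ i ∈ range (e + 1), χ p ^ i := by
  rw [Nat.divisors_prime_pow hp, Finset.sum_map]
  simp [map_pow]

/-- LOCAL FACTORISATION (§5af Lemma 1, abstract form): for a prime `p ∤ n`,
`∑_{t ∣ p^e n} χ(t) = (∑_{i ≤ e} χ(p)^i) · ∑_{t ∣ n} χ(t)`. -/
theorem divisorSum_prime_pow_mul (χ : ℕ →*₀ ℤ) {p n : ℕ} (hp : p.Prime) (hpn : ¬ p ∣ n) (e : ℕ) :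
    ∑ t ∈ (p ^ e * n).divisors, χ t = (∑ i ∈ range (e + 1), χ p ^ i) * ∑ t ∈ n.divisors, χ t := by
  have hcop : (p ^ e).Coprime n := Nat.Coprime.pow_left e ((Nat.Prime.coprime_iff_not_dvd hp).2 hpn)
  have hmul : IsMultiplicative
      ((show ArithmeticFunction ℤ from ⟨(χ : ℕ → ℤ), map_zero χ⟩) * (ζ : ArithmeticFunction ℤ)) :=
    (isMultiplicative_chi χ).mul (isMultiplicative_zeta.natCast (R := ℤ))
  rw [← chi_mul_zeta_apply, ← chi_mul_zeta_apply, ← divisorSum_prime_pow χ hp e,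
    ← chi_mul_zeta_apply, hmul.map_mul_of_coprime hcop]

/-- INERT prime, even exponent: `χ(p) = -1`, `p ∤ n` ⇒ `∑_{t ∣ p^{2e} n} χ(t) = ∑_{t ∣ n} χ(t)`. -/
theorem divisorSum_inert_even (χ : ℕ →*₀ ℤ) {p n : ℕ} (hp : p.Prime) (hpn : ¬ p ∣ n)
    (hχ : χ p = -1) (e : ℕ) :
    ∑ t ∈ (p ^ (2 * e) * n).divisors, χ t = ∑ t ∈ n.divisors, χ t := by
  rw [divisorSum_prime_pow_mul χ hp hpn, hχ, neg_one_geom_sum]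
  simp

/-- INERT prime, odd exponent: `χ(p) = -1`, `p ∤ n` ⇒ `∑_{t ∣ p^{2e+1} n} χ(t) = 0`. -/
theorem divisorSum_inert_odd (χ : ℕ →*₀ ℤ) {p n : ℕ} (hp : p.Prime) (hpn : ¬ p ∣ n)
    (hχ : χ p = -1) (e : ℕ) :
    ∑ t ∈ (p ^ (2 * e + 1) * n).divisors, χ t = 0 := by
  rw [divisorSum_prime_pow_mul χ hp hpn, hχ, neg_one_geom_sum]
  simp [Nat.even_add_one]

/-- RAMIFIED prime: `χ(p) = 0`, `p ∤ n` ⇒ `∑_{t ∣ p^e n} χ(t) = ∑_{t ∣ n} χ(t)`. -/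
theorem divisorSum_ramified (χ : ℕ →*₀ ℤ) {p n : ℕ} (hp : p.Prime) (hpn : ¬ p ∣ n)
    (hχ : χ p = 0) (e : ℕ) :
    ∑ t ∈ (p ^ e * n).divisors, χ t = ∑ t ∈ n.divisors, χ t := by
  rw [divisorSum_prime_pow_mul χ hp hpn, hχ, zero_geom_sum]
  simp

/-- SPLIT prime: `χ(p) = 1`, `p ∤ n` ⇒ `∑_{t ∣ p^e n} χ(t) = (e + 1) · ∑_{t ∣ n} χ(t)`. -/
theorem divisorSum_split (χ : ℕ →*₀ ℤ) {p n : ℕ} (hp : p.Prime) (hpn : ¬ p ∣ n)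
    (hχ : χ p = 1) (e : ℕ) :
    ∑ t ∈ (p ^ e * n).divisors, χ t = (e + 1) * ∑ t ∈ n.divisors, χ t := by
  rw [divisorSum_prime_pow_mul χ hp hpn, hχ]
  simp

/-- The parity consequence used in the cell's three-cell law, stated on the exponent directly:
for an inert prime `p ∤ n` and exponents `v r`, the sum over the divisors of `p^{v-r} n` equals the
`p`-free sum when `v - r` is even and vanishes when `v - r` is odd. -/
theorem divisorSum_inert_shift (χ : ℕ →*₀ ℤ) {p n : ℕ} (hp : p.Prime) (hpn : ¬ p ∣ n)
    (hχ : χ p = -1) (v r : ℕ) :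
    ∑ t ∈ (p ^ (v - r) * n).divisors, χ t =
      if Even (v - r) then ∑ t ∈ n.divisors, χ t else 0 := by
  rcases Nat.even_or_odd (v - r) with h | h
  · obtain ⟨e, he⟩ := h
    rw [if_pos ⟨e, he⟩, he, ← two_mul, divisorSum_inert_even χ hp hpn hχ]
  · obtain ⟨e, he⟩ := h
    rw [if_neg (Nat.not_even_iff_odd.2 ⟨e, he⟩), he, divisorSum_inert_odd χ hp hpn hχ]

end Summit.HodgeConjecture.HodgeConjecture.HodgeLocus.Census.LVLocalFactor
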